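import Summits.Parity.GeneralizedHardyLittlewood.Theorems.GreenTaoLevelTwoGITwoCyclicInverseFactorRealisations
import Summits.Parity.GeneralizedHardyLittlewood.Theorems.GreenTaoLevelTwoGITwoCyclicInverseTensorFamily

/-!
# Route `GreenTaoLevelTwo`, crux `GITwo` (stmt-Parity-21275), line `birth`, stub `stub_cyclicInverse`:
# a bracket quadratic monomial with cutoffs is a Heisenberg-class nilsequence (GT08a arXiv Lemma 69,
# assembled over every `heisenbergWith d`)

Seventy-first helper file toward the XL stub `stub_cyclicInverse` (B. Green, T. Tao, *An inverse
theorem for the Gowers `U³(G)` norm*, arXiv:math/0503014, Thm. 68 = PEMS 51 (2008) Thm. 12.8).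
Block E17 (arXiv §12, Lemma 69: "`n ↦ χ²(ξ·n)χ²(ξ'·n)e(a_{ξ,ξ'}{ξ·n}{ξ'·n})` can be written as an
elementary 2-step nilsequence"): split `a = q + s` (`q ∈ ℤ`, `|s| ≤ ½`); the torus factor carries
`χ(ξn)χ(ξ'n)e(s{ξn}{ξ'n})` (`exists_quad_factor`), and two Heisenberg factors carry
`χ(ξn)e(qαγn²/2 − qγn[αn])` and `χ(ξ'n)e(qαγn²/2 − qαn[γn])` (`exists_heis_factor` with the linear
terms tuned away); their product is `χ²χ² e(a{ξn}{ξ'n})` by the splitting identity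
`q{αn}{γn} = qαγn² − qαn[γn] − qγn[αn] + q[αn][γn]` (`toCircle_bracket_split`).  Def-free:

* `exists_tensor_pair` — binary tensor step inside the class (from `…TensorProduct`);
* `exists_bracket_quad_monomial` — for `N` odd, `ξ, ξ' ∈ ℤ/Nℤ`, `a ∈ ℝ`: a member `Z` of
  `InHeisClass (heisenbergWith d h)` and a `1`-bounded Lipschitz `Ψ, g, p` with
  `Ψ(gⁿp) = κ(ξn)²κ(ξ'n)² e(a · valMinAbs(nξ)/N · valMinAbs(nξ')/N)` for all `n ∈ ℤ`, Lipschitz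
  constant `2(L_κ + 2π + 2/(½−r₂)) + 2(4π + L_κ + 2/(½−r₂))L`.

References: [GreenTao2008U3Inverse] arXiv:math/0503014, §12, Lemma 69.
-/

noncomputable section

namespace Summit.Parity.GeneralizedHardyLittlewood.GreenTaoLevelTwoGITwoCyclicInverse

open Literature.NumberTheory.Sieve
open Literature.NumberTheory.Sieve.GreenTaoLevelTwo

/-- **Binary tensor step inside the Heisenberg class.** [cite: GreenTao2008U3Inverse, §12, Lemma 65] -/
theorem exists_tensor_pair (H : Nilmanifold 2) {X Y : Nilmanifold 2} (hX : InHeisClass H X)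
    (hY : InHeisClass H Y) {Φ₁ : X.G ⧸ X.Γ → ℂ} {Φ₂ : Y.G ⧸ Y.Γ → ℂ} (g₁ : X.G) (g₂ : Y.G)
    (p₁ : X.G ⧸ X.Γ) (p₂ : Y.G ⧸ Y.Γ) {M₁ M₂ : ℝ} (hM₁ : 0 ≤ M₁) (hM₂ : 0 ≤ M₂)
    (hb₁ : ∀ y, ‖Φ₁ y‖ ≤ 1) (hb₂ : ∀ y, ‖Φ₂ y‖ ≤ 1)
    (hL₁ : ∀ y z, ‖Φ₁ y - Φ₁ z‖ ≤ M₁ * X.dist y z) (hL₂ : ∀ y z, ‖Φ₂ y - Φ₂ z‖ ≤ M₂ * Y.dist y z) :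
    ∃ Z : Nilmanifold 2, InHeisClass H Z ∧
      ∃ (Ψ : Z.G ⧸ Z.Γ → ℂ) (g : Z.G) (p : Z.G ⧸ Z.Γ),
        (∀ y, ‖Ψ y‖ ≤ 1) ∧ (∀ y z, ‖Ψ y - Ψ z‖ ≤ (M₁ + M₂) * Z.dist y z) ∧
        ∀ n : ℤ, Ψ (g ^ n • p) = Φ₁ (g₁ ^ n • p₁) * Φ₂ (g₂ ^ n • p₂) := by
  obtain ⟨p₀, hp₀⟩ := exists_quotientProdMap_eq X Y p₁ p₂
  refine ⟨X.prod Y, InHeisClass.prod hX hY,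
    fun q => Φ₁ (Nilmanifold.quotientProdMap X Y q).1 * Φ₂ (Nilmanifold.quotientProdMap X Y q).2,
    ((g₁, g₂) : X.G × Y.G), p₀, fun q => norm_tensor_le_one hb₁ hb₂ q,
    fun q q' => norm_tensor_sub_tensor_le hM₁ hM₂ hb₁ hb₂ hL₁ hL₂ q q', fun n => ?_⟩
  have horb := quotientProdMap_zpow_smul X Y ((g₁, g₂) : X.G × Y.G) p₀ n
  show Φ₁ _ * Φ₂ _ = _
  rw [horb, hp₀]

/-- `e(u + v) = e(u) e(v)` for the circle phase. [folklore] -/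
theorem toCircle_coe_add_mul (u v : ℝ) :
    ((AddCircle.toCircle (((u + v : ℝ)) : AddCircle (1 : ℝ)) : Circle) : ℂ) =
      ((AddCircle.toCircle ((u : ℝ) : AddCircle (1 : ℝ)) : Circle) : ℂ) *
        ((AddCircle.toCircle ((v : ℝ) : AddCircle (1 : ℝ)) : Circle) : ℂ) := by
  rw [AddCircle.coe_add, AddCircle.toCircle_add, Circle.coe_mul]

/-- **A bracket quadratic monomial with cutoffs is a Heisenberg-class nilsequence (arXiv Lemma 69).**
Let `d` be a compatible metric with `ρ₀ ≤ L·d` (`L ≥ 0`), `κ : ℝ/ℤ → [0,1]` an `L_κ`-Lipschitz cutoff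
vanishing on `‖a‖ ≥ r₂` (`r₂ < ½`), `N` odd, `ξ, ξ' ∈ ℤ/Nℤ` and `a ∈ ℝ`.  Then there are a member
`Z` of the Heisenberg class of `heisenbergWith d h`, a `1`-bounded `Ψ : Z → ℂ` with Lipschitz constant
`2(L_κ + 2π + 2/(½−r₂)) + 2(4π + L_κ + 2/(½−r₂))L`, `g` and `p` with
`Ψ(gⁿp) = κ(ξn)·κ(ξ'n)·(κ(ξn)κ(ξ'n)) · e(a · valMinAbs(nξ)/N · valMinAbs(nξ')/N)` for all `n ∈ ℤ`
(`κ(ξn)` short for `κ(toAddCircle(n ξ))`). [cite: GreenTao2008U3Inverse, §12, Lemma 69] -/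
theorem exists_bracket_quad_monomial (d : HX → HX → ℝ) (h : IsCompatMetric d) {L : ℝ} (hL : 0 ≤ L)
    (hcomp : ∀ p q, heisPreDist p q ≤ L * d p q ∧ d p q ≤ L * heisPreDist p q)
    {κ : AddCircle (1 : ℝ) → ℝ} {r₂ Lκ : ℝ} (hr : r₂ < 1 / 2) (hκ : ∀ a, 0 ≤ κ a ∧ κ a ≤ 1)
    (hκ0 : ∀ a, r₂ ≤ ‖a‖ → κ a = 0) (hκL : ∀ a b, |κ a - κ b| ≤ Lκ * dist a b) (hLκ : 0 ≤ Lκ)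
    {N : ℕ} [NeZero N] (hN : Odd N) (ξ ξ' : ZMod N) (a : ℝ) :
    ∃ Z : Nilmanifold 2, InHeisClass (heisenbergWith d h) Z ∧
      ∃ (Ψ : Z.G ⧸ Z.Γ → ℂ) (g : Z.G) (p : Z.G ⧸ Z.Γ),
        (∀ y, ‖Ψ y‖ ≤ 1) ∧
        (∀ y z, ‖Ψ y - Ψ z‖ ≤ (2 * (Lκ + 2 * Real.pi + 2 / (1 / 2 - r₂)) +
            2 * ((4 * Real.pi + Lκ + 2 / (1 / 2 - r₂)) * L)) * Z.dist y z) ∧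
        ∀ n : ℤ, Ψ (g ^ n • p) =
          ((κ (ZMod.toAddCircle ((n : ZMod N) * ξ)) : ℂ) * (κ (ZMod.toAddCircle ((n : ZMod N) * ξ')) : ℂ)) *
          (((κ (ZMod.toAddCircle ((n : ZMod N) * ξ)) : ℂ) * (κ (ZMod.toAddCircle ((n : ZMod N) * ξ')) : ℂ)) *
            ((AddCircle.toCircle (((a * ((((n : ZMod N) * ξ).valMinAbs : ℝ) / N) *
              ((((n : ZMod N) * ξ').valMinAbs : ℝ) / N) : ℝ)) : AddCircle (1 : ℝ)) : Circle) : ℂ)) := by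
  -- split `a = q + s`
  obtain ⟨q, s, has, hs⟩ := exists_int_add_small a
  set α : ℝ := (ξ.valMinAbs : ℝ) / N with hα
  set γ : ℝ := (ξ'.valMinAbs : ℝ) / N with hγ
  have hgap : 0 < 1 / 2 - r₂ := by linarith
  -- the three factors
  obtain ⟨Φ₁, g₁, p₁, hb₁, hL₁, horb₁⟩ := exists_quad_factor hr hκ hκ0 hκL hLκ ξ ξ' s
    (by norm_num : 1 ≤ 2)
  obtain ⟨Φ₂, g₂, p₂, hb₂, hL₂, horb₂⟩ := exists_heis_factor d h hcomp hr hκ hκ0 hκL hLκ ξ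
    (q * γ) (-(q * γ) / 2 + q * γ * α / 2) 0
  obtain ⟨Φ₃, g₃, p₃, hb₃, hL₃, horb₃⟩ := exists_heis_factor d h hcomp hr hκ hκ0 hκL hLκ ξ'
    (q * α) (-(q * α) / 2 + q * α * γ / 2) 0
  -- Lipschitz constants
  have hK₁ : 0 ≤ 2 * (Lκ + 2 * Real.pi * |s| + 2 / (1 / 2 - r₂)) := by positivity
  have hK₂ : 0 ≤ (4 * Real.pi + Lκ + 2 / (1 / 2 - r₂)) * L := by positivity
  have hK₁' : 2 * (Lκ + 2 * Real.pi * |s| + 2 / (1 / 2 - r₂)) ≤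
      2 * (Lκ + 2 * Real.pi + 2 / (1 / 2 - r₂)) := by
    have : 2 * Real.pi * |s| ≤ 2 * Real.pi := by nlinarith [Real.pi_pos, abs_nonneg s]
    linarith
  -- tensor: first the two Heisenberg factors, then the torus factor
  obtain ⟨Z₂₃, hZ₂₃, Ψ₂₃, g₂₃, p₂₃, hb₂₃, hL₂₃, horb₂₃⟩ := exists_tensor_pair (heisenbergWith d h)
    InHeisClass.heis InHeisClass.heis g₂ g₃ p₂ p₃ hK₂ hK₂ hb₂ hb₃ hL₂ hL₃
  obtain ⟨Z, hZ, Ψ, g, p, hb, hLZ, horb⟩ := exists_tensor_pair (heisenbergWith d h)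
    (InHeisClass.prod InHeisClass.circle InHeisClass.circle) hZ₂₃ g₁ g₂₃ p₁ p₂₃ hK₁
    (add_nonneg hK₂ hK₂) hb₁ hb₂₃ hL₁ hL₂₃
  refine ⟨Z, hZ, Ψ, g, p, hb, fun y z => (hLZ y z).trans ?_, fun n => ?_⟩
  · refine mul_le_mul_of_nonneg_right ?_ (Z.dist_nonneg y z)
    linarith
  · rw [horb n, horb₂₃ n, horb₁ n, horb₂ n, horb₃ n]
    -- the phase bookkeeping
    set m : ℝ := ((((n : ZMod N) * ξ).valMinAbs : ℝ)) / N with hm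
    set m' : ℝ := ((((n : ZMod N) * ξ').valMinAbs : ℝ)) / N with hm'
    set K₁ := (κ (ZMod.toAddCircle ((n : ZMod N) * ξ)) : ℂ)
    set K₂ := (κ (ZMod.toAddCircle ((n : ZMod N) * ξ')) : ℂ)
    -- `m = nα − [nα]`, `m' = nγ − [nγ]`
    have hmα : m = n * α - round ((n : ℝ) * α) := by
      have e : (n : ZMod N) * ξ = (((n * ξ.valMinAbs : ℤ)) : ZMod N) := by
        rw [Int.cast_mul, ZMod.coe_valMinAbs]
      rw [hm, e, valMinAbs_div_eq hN, hα]
      push_cast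
      rw [show (n : ℝ) * (ξ.valMinAbs : ℝ) / N = n * ((ξ.valMinAbs : ℝ) / N) by ring]
    have hmγ : m' = n * γ - round ((n : ℝ) * γ) := by
      have e : (n : ZMod N) * ξ' = (((n * ξ'.valMinAbs : ℤ)) : ZMod N) := by
        rw [Int.cast_mul, ZMod.coe_valMinAbs]
      rw [hm', e, valMinAbs_div_eq hN, hγ]
      push_cast
      rw [show (n : ℝ) * (ξ'.valMinAbs : ℝ) / N = n * ((ξ'.valMinAbs : ℝ) / N) by ring]
    -- `e(a m m') = e(s m m') · e(q(nα − k)(nγ − k'))`, and the splitting identity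
    have hsplit : ((AddCircle.toCircle (((a * m * m' : ℝ)) : AddCircle (1 : ℝ)) : Circle) : ℂ) =
        ((AddCircle.toCircle (((s * m * m' : ℝ)) : AddCircle (1 : ℝ)) : Circle) : ℂ) *
          (((AddCircle.toCircle (((0 + n * (-(q * γ) / 2 + q * γ * α / 2 + q * γ / 2 - q * γ * α / 2) +
              (n : ℝ) ^ 2 * (q * γ * α / 2) - q * γ * n * round ((n : ℝ) * α) : ℝ)) :
                AddCircle (1 : ℝ)) : Circle) : ℂ) *
          ((AddCircle.toCircle (((0 + n * (-(q * α) / 2 + q * α * γ / 2 + q * α / 2 - q * α * γ / 2) +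
              (n : ℝ) ^ 2 * (q * α * γ / 2) - q * α * n * round ((n : ℝ) * γ) : ℝ)) :
                AddCircle (1 : ℝ)) : Circle) : ℂ)) := by
      have key : ∀ u v : ℝ, u = v →
          ((AddCircle.toCircle ((u : ℝ) : AddCircle (1 : ℝ)) : Circle) : ℂ) =
            ((AddCircle.toCircle ((v : ℝ) : AddCircle (1 : ℝ)) : Circle) : ℂ) := fun u v huv => by rw [huv]
      have e1 : a * m * m' = s * m * m' + q * (n * α - round ((n : ℝ) * α)) *
          (n * γ - round ((n : ℝ) * γ)) := by rw [has, hmα, hmγ]; ring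
      rw [e1, toCircle_coe_add_mul, toCircle_bracket_split,
        ← toCircle_coe_add_mul (0 + n * (-(q * γ) / 2 + q * γ * α / 2 + q * γ / 2 - q * γ * α / 2) +
              (n : ℝ) ^ 2 * (q * γ * α / 2) - q * γ * n * round ((n : ℝ) * α))]
      congr 1
      exact key _ _ (by ring)
    rw [hsplit]
    ring

end Summit.Parity.GeneralizedHardyLittlewood.GreenTaoLevelTwoGITwoCyclicInverse
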